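import Summits.Ventures.HodgeRepro.Night4ReducedDimQuads
import Summits.Ventures.HodgeRepro.Night4ReducedDimTwelveAbelian
import Summits.Ventures.HodgeRepro.Night4ReducedDimTwelveNonabelian

/-!
# Beyond the census faces in degree 12: fourfolds closed by Markman, and open sevenfolds / eightfolds — witnesses

Blind re-derivation cell `pub-hodge-repro`, seat `night-4` (ROUTE HARDENING for the Monday FINAL, gen 5).  Target tree
path `lean/Summits/Ventures/HodgeRepro/Night4ReducedDimQuadWitnesses.lean`.

ROUTE.md v2.89 §3.4 tabulates `dim B_red` for the CENSUS faces of degree 12 (`≥ 9`; parts I–IV) and counts the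
non-census conjugate-free `SumTwo` quadruples (patterns `(3,2,1)` and `(2,2,2)`, §3.1) without tabulating them; §3.5 (i)
names the census ninefolds as the smallest open objects of degree 12.  The seat's Python census of ALL conjugate-free
`SumTwo` quadruples of the six `(G, c)` of order 12 (proofs/night-4/g5/quads12.py: 17280 quadruples with `T 0 ∋ 1` per
`(G, c)`) finds, in the pattern `(2,2,2)`, reduced varieties SMALLER than the census ones — exactly the shape of the
degree-6 faces (§3.2: three translates of one type plus one lift):

* `dim B_red = 4` on `C6 × C2` and on `D6` — `E × S₃`, a FOURFOLD: its Weil line is algebraic by Lemma R + Markman 2025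
  Cor 1.6.1 (the route's closed regime), exactly as for every degree-6 face; on `C6 × C2` the witness is the inflation
  to degree 12 of a degree-6 face of a sextic CM subfield (all corners right-invariant under `(3, 1)`,
  `night4Quad_C6xC2_four_induced`), on `D6` it is NOT (no common right stabiliser, `night4Quad_D6_four_not_induced`:
  its three threefold corners are lifts from three conjugate non-Galois sextic subfields);
* `dim B_red = 7` on `C6 × C2` (`E × A₆`) and `dim B_red = 8` on `C12` and `Dic3` (`S₂ × A₆`) — OPEN objects of degree 12
  strictly smaller than the census ninefolds (and than the value sets `{12, …}` / `{14, …}` of `C12` / `Dic3`), comparable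
  to the degree-8 sevenfold and eightfolds of §3.5 (i).

This file certifies ONE witness quadruple for each of these five values on the kernel — CM types, `SumTwo`, conjugate-free,
pairwise distinct, pattern `(2,2,2)`, the simple dimensions, the class structure, `redDim`, and the roster form
(`TypeDatum.isFace_prodDatum_of_sumTwo`: every conjugate-free `SumTwo` quadruple of pairwise distinct CM types is a
face of the roster on its product datum, as the census faces are by `TypeDatum.isFace_faceCorners`).  The complete
value sets (quads12.py: C12 {8, 12, 14, 18, 20, 24}; C6 × C2 {4, 7, 9, 10, 12, 13, 14, 15, 16, 18, 19, 21, 24}; D6 {4, 9, 10,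
12, 13, 14, 15, 16, 18}; Dic3 {8, 12, 14, 18, 20, 24}) are NOT on the kernel: the table method of `Night4ReducedDimQuads`
was measured at ≈ 15 ms per enumerated candidate and ≈ 80 ms per `redDimFirst` in `Finset` arithmetic — ≈ 11 minutes of
kernel time per `(G, c)`, beyond one file's budget (a bit-mask engine would be needed).  Nothing here says anything about
the status of the Hodge conjecture for CM abelian varieties, which is NOT proved.
-/

set_option autoImplicit false

open Finset
open scoped Pointwise

namespace HodgeRepro

/-! ## Every conjugate-free `SumTwo` quadruple of distinct CM types is a face of the roster -/

section Roster

variable {G : Type} [Group G] [Fintype G] [DecidableEq G] {c : G}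

/-- **Every conjugate-free `SumTwo` quadruple of pairwise distinct CM types is a face of the roster** on its product
datum (the diagonal `diagFour`), exactly as the census faces are (`NightOpenInputs.TypeDatum.isFace_faceCorners`). -/
theorem Route.TypeDatum.isFace_prodDatum_of_sumTwo (hc : IsComplexConj c) (T : Fin 4 → Finset G)
    (hT : ∀ i, IsCMType c (T i)) (hsum : SumTwo T) (hinj : Function.Injective T) (hconj : ConjFree c T) :
    (Route.TypeDatum.prodDatum hc T hT).IsFace (Route.diagFour (G := G)) := by
  refine ⟨Route.card_diagFour, Route.TypeDatum.eq2_diagFour_of_sumTwo hc T hT hsum, ?_, ?_⟩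
  · rintro ⟨i, x⟩ hx ⟨j, y⟩ hy h
    have hx' : x = 1 := (Route.mem_diagFour _).1 hx
    have hy' : y = 1 := (Route.mem_diagFour _).1 hy
    subst hx' hy'
    rw [Route.TypeDatum.liftedType_prodDatum, Route.TypeDatum.liftedType_prodDatum] at h
    rw [hinj h]
  · rintro ⟨i, x⟩ hx ⟨j, y⟩ hy
    have hx' : x = 1 := (Route.mem_diagFour _).1 hx
    have hy' : y = 1 := (Route.mem_diagFour _).1 hy
    subst hx' hy'
    rw [Route.TypeDatum.liftedType_prodDatum, Route.TypeDatum.liftedType_prodDatum]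
    by_cases hij : i = j
    · subst hij
      intro h
      change T i = c • T i at h
      have := (hT i).disjoint_smul hc
      rw [← h] at this
      exact (hT i).ne_empty ((Finset.disjoint_self_iff_empty _).1 this)
    · exact hconj i j hij

end Roster

/-! ## `C6xC2`: `E × S₃` -/

/-- The quadruple — `E × S₃`: corner 2 is a lift from an imaginary quadratic subfield (`simpleDim 1`), corners 0, 1, 3 are three right translates of one type lifted from a sextic CM subfield (`simpleDim 3`, one isogeny class) — a FOURFOLD, like the reduced variety of every degree-6 face (ROUTE.md §3.2): CLOSED by Markman 2025 Cor 1.6.1 through Lemma R. -/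
def night4Quad_C6xC2_four : Fin 4 → Finset C6xC2 :=
  ![night4Type_C6xC2 [(0, 0), (1, 1), (2, 1), (3, 1), (4, 0), (5, 0)],
    night4Type_C6xC2 [(0, 1), (1, 1), (2, 0), (3, 0), (4, 0), (5, 1)],
    night4Type_C6xC2 [(0, 1), (1, 0), (2, 1), (3, 0), (4, 1), (5, 0)],
    night4Type_C6xC2 [(0, 0), (1, 0), (2, 0), (3, 1), (4, 1), (5, 1)]]

/-- Its corners are CM types. -/
theorem night4Quad_C6xC2_four_isCMType : ∀ i, IsCMType cc_C6xC2 (night4Quad_C6xC2_four i) := by decide +kernel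

/-- It is an (eq2)-quadruple: every embedding lies in exactly two corners. -/
theorem night4Quad_C6xC2_four_sumTwo : SumTwo night4Quad_C6xC2_four := by decide +kernel

/-- No corner is the conjugate of another. -/
theorem night4Quad_C6xC2_four_conjFree : ConjFree cc_C6xC2 night4Quad_C6xC2_four := by decide +kernel

/-- The corners are pairwise distinct. -/
theorem night4Quad_C6xC2_four_injective : Function.Injective night4Quad_C6xC2_four := by decide +kernel

/-- Its pairing pattern is `(2, 2, 2)`: corner 0 meets each other corner in two embeddings — NOT a census face, whose
pattern is `(4, 1, 1)` in degree 12 (ROUTE.md §3.1; typer's `shared_faceCorners_one/two/three`). -/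
theorem night4Quad_C6xC2_four_pattern : (night4Quad_C6xC2_four 0 ∩ night4Quad_C6xC2_four 1).card = 2 ∧ (night4Quad_C6xC2_four 0 ∩ night4Quad_C6xC2_four 2).card = 2 ∧
    (night4Quad_C6xC2_four 0 ∩ night4Quad_C6xC2_four 3).card = 2 := by decide +kernel

/-- The dimensions of the simple factors of the corners. -/
theorem night4Quad_C6xC2_four_simpleDim : simpleDim (night4Quad_C6xC2_four 0) = 3 ∧ simpleDim (night4Quad_C6xC2_four 1) = 3 ∧ simpleDim (night4Quad_C6xC2_four 2) = 1 ∧ simpleDim (night4Quad_C6xC2_four 3) = 3 := by decide +kernel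

/-- The three corners of one isogeny class. -/
theorem night4Quad_C6xC2_four_sameClass : SameClass (night4Quad_C6xC2_four 0) (night4Quad_C6xC2_four 1) ∧ SameClass (night4Quad_C6xC2_four 0) (night4Quad_C6xC2_four 3) ∧ SameClass (night4Quad_C6xC2_four 1) (night4Quad_C6xC2_four 3) := by decide +kernel

/-- All four corners are right-invariant under `(3, 1)`: the quadruple is the INFLATION to degree 12 of a degree-6 face
of the sextic CM subfield `F^{⟨(3, 1)⟩}` (ROUTE.md §3.2's `B_red = A × E`, lifted). -/
theorem night4Quad_C6xC2_four_induced :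
    ∀ i, rmul (night4Quad_C6xC2_four i) (Multiplicative.ofAdd (3, 1)) = night4Quad_C6xC2_four i := by
  decide +kernel

/-- **`dim B_red = 4`.**  KERNEL. -/
theorem night4Quad_C6xC2_four_redDim : redDim night4Quad_C6xC2_four = 4 := by
  rw [redDim_eq_redDimFirst]
  decide +kernel

/-- The quadruple is a face of the roster (`NightOpenInputs.TypeDatum.IsFace`) on its product datum, with
`TypeDatum.redDim diagFour = 4`. -/
theorem night4Quad_C6xC2_four_isFace :
    (Route.TypeDatum.prodDatum cc_C6xC2_isComplexConj night4Quad_C6xC2_four night4Quad_C6xC2_four_isCMType).IsFace Route.diagFour ∧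
    (Route.TypeDatum.prodDatum cc_C6xC2_isComplexConj night4Quad_C6xC2_four night4Quad_C6xC2_four_isCMType).redDim Route.diagFour = 4 :=
  ⟨Route.TypeDatum.isFace_prodDatum_of_sumTwo cc_C6xC2_isComplexConj night4Quad_C6xC2_four night4Quad_C6xC2_four_isCMType night4Quad_C6xC2_four_sumTwo
      night4Quad_C6xC2_four_injective night4Quad_C6xC2_four_conjFree,
    by rw [Route.TypeDatum.redDim_prodDatum]; exact night4Quad_C6xC2_four_redDim⟩

/-! ## `C6xC2`: `E × A₆` -/

/-- The quadruple — `E × A₆`: corner 2 is a lift from an imaginary quadratic subfield (`simpleDim 1`), corners 0, 1, 3 three right translates of one primitive type (a simple CM sixfold) — a SEVENFOLD, an OPEN object of degree 12 smaller than the census ninefolds of §3.5 (i). -/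
def night4Quad_C6xC2_seven : Fin 4 → Finset C6xC2 :=
  ![night4Type_C6xC2 [(0, 0), (3, 1), (4, 0), (4, 1), (5, 0), (5, 1)],
    night4Type_C6xC2 [(1, 1), (2, 0), (2, 1), (3, 0), (3, 1), (4, 0)],
    night4Type_C6xC2 [(0, 1), (1, 0), (2, 1), (3, 0), (4, 1), (5, 0)],
    night4Type_C6xC2 [(0, 0), (0, 1), (1, 0), (1, 1), (2, 0), (5, 1)]]

/-- Its corners are CM types. -/
theorem night4Quad_C6xC2_seven_isCMType : ∀ i, IsCMType cc_C6xC2 (night4Quad_C6xC2_seven i) := by decide +kernel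

/-- It is an (eq2)-quadruple: every embedding lies in exactly two corners. -/
theorem night4Quad_C6xC2_seven_sumTwo : SumTwo night4Quad_C6xC2_seven := by decide +kernel

/-- No corner is the conjugate of another. -/
theorem night4Quad_C6xC2_seven_conjFree : ConjFree cc_C6xC2 night4Quad_C6xC2_seven := by decide +kernel

/-- The corners are pairwise distinct. -/
theorem night4Quad_C6xC2_seven_injective : Function.Injective night4Quad_C6xC2_seven := by decide +kernel

/-- Its pairing pattern is `(2, 2, 2)`: corner 0 meets each other corner in two embeddings — NOT a census face, whose
pattern is `(4, 1, 1)` in degree 12 (ROUTE.md §3.1; typer's `shared_faceCorners_one/two/three`). -/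
theorem night4Quad_C6xC2_seven_pattern : (night4Quad_C6xC2_seven 0 ∩ night4Quad_C6xC2_seven 1).card = 2 ∧ (night4Quad_C6xC2_seven 0 ∩ night4Quad_C6xC2_seven 2).card = 2 ∧
    (night4Quad_C6xC2_seven 0 ∩ night4Quad_C6xC2_seven 3).card = 2 := by decide +kernel

/-- The dimensions of the simple factors of the corners. -/
theorem night4Quad_C6xC2_seven_simpleDim : simpleDim (night4Quad_C6xC2_seven 0) = 6 ∧ simpleDim (night4Quad_C6xC2_seven 1) = 6 ∧ simpleDim (night4Quad_C6xC2_seven 2) = 1 ∧ simpleDim (night4Quad_C6xC2_seven 3) = 6 := by decide +kernel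

/-- The three corners of one isogeny class. -/
theorem night4Quad_C6xC2_seven_sameClass : SameClass (night4Quad_C6xC2_seven 0) (night4Quad_C6xC2_seven 1) ∧ SameClass (night4Quad_C6xC2_seven 0) (night4Quad_C6xC2_seven 3) ∧ SameClass (night4Quad_C6xC2_seven 1) (night4Quad_C6xC2_seven 3) := by decide +kernel

/-- **`dim B_red = 7`.**  KERNEL. -/
theorem night4Quad_C6xC2_seven_redDim : redDim night4Quad_C6xC2_seven = 7 := by
  rw [redDim_eq_redDimFirst]
  decide +kernel

/-- The quadruple is a face of the roster (`NightOpenInputs.TypeDatum.IsFace`) on its product datum, with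
`TypeDatum.redDim diagFour = 7`. -/
theorem night4Quad_C6xC2_seven_isFace :
    (Route.TypeDatum.prodDatum cc_C6xC2_isComplexConj night4Quad_C6xC2_seven night4Quad_C6xC2_seven_isCMType).IsFace Route.diagFour ∧
    (Route.TypeDatum.prodDatum cc_C6xC2_isComplexConj night4Quad_C6xC2_seven night4Quad_C6xC2_seven_isCMType).redDim Route.diagFour = 7 :=
  ⟨Route.TypeDatum.isFace_prodDatum_of_sumTwo cc_C6xC2_isComplexConj night4Quad_C6xC2_seven night4Quad_C6xC2_seven_isCMType night4Quad_C6xC2_seven_sumTwo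
      night4Quad_C6xC2_seven_injective night4Quad_C6xC2_seven_conjFree,
    by rw [Route.TypeDatum.redDim_prodDatum]; exact night4Quad_C6xC2_seven_redDim⟩

/-! ## `D6`: `E × S₃` on `D6` -/

/-- The quadruple — `E × S₃` on `D6`: corners 0, 1, 3 are three right translates of one type lifted from a sextic CM subfield (`simpleDim 3`), corner 2 a lift from an imaginary quadratic subfield (`simpleDim 1`) — a FOURFOLD, closed by Markman 2025 Cor 1.6.1 through Lemma R. -/
def night4Quad_D6_four : Fin 4 → Finset D6 :=
  ![night4Type_D6 [0, 4, 5] [3, 4, 5],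
    night4Type_D6 [2, 3, 4] [1, 2, 3],
    night4Type_D6 [1, 3, 5] [0, 2, 4],
    night4Type_D6 [0, 1, 2] [0, 1, 5]]

/-- Its corners are CM types. -/
theorem night4Quad_D6_four_isCMType : ∀ i, IsCMType cc_D6 (night4Quad_D6_four i) := by decide +kernel

/-- It is an (eq2)-quadruple: every embedding lies in exactly two corners. -/
theorem night4Quad_D6_four_sumTwo : SumTwo night4Quad_D6_four := by decide +kernel

/-- No corner is the conjugate of another. -/
theorem night4Quad_D6_four_conjFree : ConjFree cc_D6 night4Quad_D6_four := by decide +kernel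

/-- The corners are pairwise distinct. -/
theorem night4Quad_D6_four_injective : Function.Injective night4Quad_D6_four := by decide +kernel

/-- Its pairing pattern is `(2, 2, 2)`: corner 0 meets each other corner in two embeddings — NOT a census face, whose
pattern is `(4, 1, 1)` in degree 12 (ROUTE.md §3.1; typer's `shared_faceCorners_one/two/three`). -/
theorem night4Quad_D6_four_pattern : (night4Quad_D6_four 0 ∩ night4Quad_D6_four 1).card = 2 ∧ (night4Quad_D6_four 0 ∩ night4Quad_D6_four 2).card = 2 ∧
    (night4Quad_D6_four 0 ∩ night4Quad_D6_four 3).card = 2 := by decide +kernel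

/-- The dimensions of the simple factors of the corners. -/
theorem night4Quad_D6_four_simpleDim : simpleDim (night4Quad_D6_four 0) = 3 ∧ simpleDim (night4Quad_D6_four 1) = 3 ∧ simpleDim (night4Quad_D6_four 2) = 1 ∧ simpleDim (night4Quad_D6_four 3) = 3 := by decide +kernel

/-- The three corners of one isogeny class. -/
theorem night4Quad_D6_four_sameClass : SameClass (night4Quad_D6_four 0) (night4Quad_D6_four 1) ∧ SameClass (night4Quad_D6_four 0) (night4Quad_D6_four 3) ∧ SameClass (night4Quad_D6_four 1) (night4Quad_D6_four 3) := by decide +kernel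

/-- No non-trivial element of `D6` fixes all four corners on the right: this fourfold quadruple is NOT the inflation of a
degree-6 face of one sextic subfield — its three threefold corners are Galois-conjugate lifts from three different
(conjugate, non-Galois) sextic CM subfields `F^{⟨sr i⟩}`, a phenomenon of degree 12 itself. -/
theorem night4Quad_D6_four_not_induced :
    ∀ h : D6, h ≠ 1 → ∃ i, rmul (night4Quad_D6_four i) h ≠ night4Quad_D6_four i := by
  decide +kernel

/-- **`dim B_red = 4`.**  KERNEL. -/
theorem night4Quad_D6_four_redDim : redDim night4Quad_D6_four = 4 := by
  rw [redDim_eq_redDimFirst]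
  decide +kernel

/-- The quadruple is a face of the roster (`NightOpenInputs.TypeDatum.IsFace`) on its product datum, with
`TypeDatum.redDim diagFour = 4`. -/
theorem night4Quad_D6_four_isFace :
    (Route.TypeDatum.prodDatum cc_D6_isComplexConj night4Quad_D6_four night4Quad_D6_four_isCMType).IsFace Route.diagFour ∧
    (Route.TypeDatum.prodDatum cc_D6_isComplexConj night4Quad_D6_four night4Quad_D6_four_isCMType).redDim Route.diagFour = 4 :=
  ⟨Route.TypeDatum.isFace_prodDatum_of_sumTwo cc_D6_isComplexConj night4Quad_D6_four night4Quad_D6_four_isCMType night4Quad_D6_four_sumTwo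
      night4Quad_D6_four_injective night4Quad_D6_four_conjFree,
    by rw [Route.TypeDatum.redDim_prodDatum]; exact night4Quad_D6_four_redDim⟩

/-! ## `C12`: `S₂ × A₆` on `C12` -/

/-- The quadruple — `S₂ × A₆` on `C12`: corner 2 is a lift from the quartic CM subfield (`simpleDim 2`), corners 0, 1, 3 three right translates of one primitive type (a simple CM sixfold) — an EIGHTFOLD, an OPEN object of degree 12 smaller than the census value set {12, 14, 18, 20, 24} of `C12`. -/
def night4Quad_C12_eight : Fin 4 → Finset C12 :=
  ![night4Type_C12 [0, 7, 8, 9, 10, 11],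
    night4Type_C12 [3, 4, 5, 6, 7, 8],
    night4Type_C12 [1, 2, 5, 6, 9, 10],
    night4Type_C12 [0, 1, 2, 3, 4, 11]]

/-- Its corners are CM types. -/
theorem night4Quad_C12_eight_isCMType : ∀ i, IsCMType cc_C12 (night4Quad_C12_eight i) := by decide +kernel

/-- It is an (eq2)-quadruple: every embedding lies in exactly two corners. -/
theorem night4Quad_C12_eight_sumTwo : SumTwo night4Quad_C12_eight := by decide +kernel

/-- No corner is the conjugate of another. -/
theorem night4Quad_C12_eight_conjFree : ConjFree cc_C12 night4Quad_C12_eight := by decide +kernel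

/-- The corners are pairwise distinct. -/
theorem night4Quad_C12_eight_injective : Function.Injective night4Quad_C12_eight := by decide +kernel

/-- Its pairing pattern is `(2, 2, 2)`: corner 0 meets each other corner in two embeddings — NOT a census face, whose
pattern is `(4, 1, 1)` in degree 12 (ROUTE.md §3.1; typer's `shared_faceCorners_one/two/three`). -/
theorem night4Quad_C12_eight_pattern : (night4Quad_C12_eight 0 ∩ night4Quad_C12_eight 1).card = 2 ∧ (night4Quad_C12_eight 0 ∩ night4Quad_C12_eight 2).card = 2 ∧
    (night4Quad_C12_eight 0 ∩ night4Quad_C12_eight 3).card = 2 := by decide +kernel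

/-- The dimensions of the simple factors of the corners. -/
theorem night4Quad_C12_eight_simpleDim : simpleDim (night4Quad_C12_eight 0) = 6 ∧ simpleDim (night4Quad_C12_eight 1) = 6 ∧ simpleDim (night4Quad_C12_eight 2) = 2 ∧ simpleDim (night4Quad_C12_eight 3) = 6 := by decide +kernel

/-- The three corners of one isogeny class. -/
theorem night4Quad_C12_eight_sameClass : SameClass (night4Quad_C12_eight 0) (night4Quad_C12_eight 1) ∧ SameClass (night4Quad_C12_eight 0) (night4Quad_C12_eight 3) ∧ SameClass (night4Quad_C12_eight 1) (night4Quad_C12_eight 3) := by decide +kernel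

/-- **`dim B_red = 8`.**  KERNEL. -/
theorem night4Quad_C12_eight_redDim : redDim night4Quad_C12_eight = 8 := by
  rw [redDim_eq_redDimFirst]
  decide +kernel

/-- The quadruple is a face of the roster (`NightOpenInputs.TypeDatum.IsFace`) on its product datum, with
`TypeDatum.redDim diagFour = 8`. -/
theorem night4Quad_C12_eight_isFace :
    (Route.TypeDatum.prodDatum cc_C12_isComplexConj night4Quad_C12_eight night4Quad_C12_eight_isCMType).IsFace Route.diagFour ∧
    (Route.TypeDatum.prodDatum cc_C12_isComplexConj night4Quad_C12_eight night4Quad_C12_eight_isCMType).redDim Route.diagFour = 8 :=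
  ⟨Route.TypeDatum.isFace_prodDatum_of_sumTwo cc_C12_isComplexConj night4Quad_C12_eight night4Quad_C12_eight_isCMType night4Quad_C12_eight_sumTwo
      night4Quad_C12_eight_injective night4Quad_C12_eight_conjFree,
    by rw [Route.TypeDatum.redDim_prodDatum]; exact night4Quad_C12_eight_redDim⟩

/-! ## `Dic3`: `S₂ × A₆` on `Dic3` -/

/-- The quadruple — `S₂ × A₆` on `Dic3`: corner 2 is a lift from the quartic CM subfield (`simpleDim 2`), corners 0, 1, 3 three right translates of one primitive type — an EIGHTFOLD, an OPEN object of degree 12 smaller than the census value set {14, 18, 20, 24} of `Dic3`. -/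
def night4Quad_Dic3_eight : Fin 4 → Finset Dic3 :=
  ![night4Type_Dic3 [0, 4, 5] [3, 4, 5],
    night4Type_Dic3 [2, 3, 4] [1, 2, 3],
    night4Type_Dic3 [1, 3, 5] [0, 2, 4],
    night4Type_Dic3 [0, 1, 2] [0, 1, 5]]

/-- Its corners are CM types. -/
theorem night4Quad_Dic3_eight_isCMType : ∀ i, IsCMType cc_Dic3 (night4Quad_Dic3_eight i) := by decide +kernel

/-- It is an (eq2)-quadruple: every embedding lies in exactly two corners. -/
theorem night4Quad_Dic3_eight_sumTwo : SumTwo night4Quad_Dic3_eight := by decide +kernel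

/-- No corner is the conjugate of another. -/
theorem night4Quad_Dic3_eight_conjFree : ConjFree cc_Dic3 night4Quad_Dic3_eight := by decide +kernel

/-- The corners are pairwise distinct. -/
theorem night4Quad_Dic3_eight_injective : Function.Injective night4Quad_Dic3_eight := by decide +kernel

/-- Its pairing pattern is `(2, 2, 2)`: corner 0 meets each other corner in two embeddings — NOT a census face, whose
pattern is `(4, 1, 1)` in degree 12 (ROUTE.md §3.1; typer's `shared_faceCorners_one/two/three`). -/
theorem night4Quad_Dic3_eight_pattern : (night4Quad_Dic3_eight 0 ∩ night4Quad_Dic3_eight 1).card = 2 ∧ (night4Quad_Dic3_eight 0 ∩ night4Quad_Dic3_eight 2).card = 2 ∧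
    (night4Quad_Dic3_eight 0 ∩ night4Quad_Dic3_eight 3).card = 2 := by decide +kernel

/-- The dimensions of the simple factors of the corners. -/
theorem night4Quad_Dic3_eight_simpleDim : simpleDim (night4Quad_Dic3_eight 0) = 6 ∧ simpleDim (night4Quad_Dic3_eight 1) = 6 ∧ simpleDim (night4Quad_Dic3_eight 2) = 2 ∧ simpleDim (night4Quad_Dic3_eight 3) = 6 := by decide +kernel

/-- The three corners of one isogeny class. -/
theorem night4Quad_Dic3_eight_sameClass : SameClass (night4Quad_Dic3_eight 0) (night4Quad_Dic3_eight 1) ∧ SameClass (night4Quad_Dic3_eight 0) (night4Quad_Dic3_eight 3) ∧ SameClass (night4Quad_Dic3_eight 1) (night4Quad_Dic3_eight 3) := by decide +kernel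

/-- **`dim B_red = 8`.**  KERNEL. -/
theorem night4Quad_Dic3_eight_redDim : redDim night4Quad_Dic3_eight = 8 := by
  rw [redDim_eq_redDimFirst]
  decide +kernel

/-- The quadruple is a face of the roster (`NightOpenInputs.TypeDatum.IsFace`) on its product datum, with
`TypeDatum.redDim diagFour = 8`. -/
theorem night4Quad_Dic3_eight_isFace :
    (Route.TypeDatum.prodDatum cc_Dic3_isComplexConj night4Quad_Dic3_eight night4Quad_Dic3_eight_isCMType).IsFace Route.diagFour ∧
    (Route.TypeDatum.prodDatum cc_Dic3_isComplexConj night4Quad_Dic3_eight night4Quad_Dic3_eight_isCMType).redDim Route.diagFour = 8 :=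
  ⟨Route.TypeDatum.isFace_prodDatum_of_sumTwo cc_Dic3_isComplexConj night4Quad_Dic3_eight night4Quad_Dic3_eight_isCMType night4Quad_Dic3_eight_sumTwo
      night4Quad_Dic3_eight_injective night4Quad_Dic3_eight_conjFree,
    by rw [Route.TypeDatum.redDim_prodDatum]; exact night4Quad_Dic3_eight_redDim⟩

/-! ## Summary: the five values exist -/

/-- **Degree 12 beyond the census: `dim B_red = 4` (fourfolds, closed by Markman via Lemma R) on `C6 × C2` and `D6`; `7` on
`C6 × C2`; `8` on `C12` and `Dic3` — each on a conjugate-free `SumTwo` quadruple of pairwise distinct CM types.** -/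
theorem exists_quad_small_deg12 :
    (∃ T : Fin 4 → Finset C6xC2, (∀ i, IsCMType cc_C6xC2 (T i)) ∧ SumTwo T ∧ ConjFree cc_C6xC2 T ∧
      Function.Injective T ∧ redDim T = 4) ∧
    (∃ T : Fin 4 → Finset D6, (∀ i, IsCMType cc_D6 (T i)) ∧ SumTwo T ∧ ConjFree cc_D6 T ∧ Function.Injective T ∧
      redDim T = 4) ∧
    (∃ T : Fin 4 → Finset C6xC2, (∀ i, IsCMType cc_C6xC2 (T i)) ∧ SumTwo T ∧ ConjFree cc_C6xC2 T ∧
      Function.Injective T ∧ redDim T = 7) ∧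
    (∃ T : Fin 4 → Finset C12, (∀ i, IsCMType cc_C12 (T i)) ∧ SumTwo T ∧ ConjFree cc_C12 T ∧ Function.Injective T ∧
      redDim T = 8) ∧
    (∃ T : Fin 4 → Finset Dic3, (∀ i, IsCMType cc_Dic3 (T i)) ∧ SumTwo T ∧ ConjFree cc_Dic3 T ∧ Function.Injective T ∧
      redDim T = 8) :=
  ⟨⟨_, night4Quad_C6xC2_four_isCMType, night4Quad_C6xC2_four_sumTwo, night4Quad_C6xC2_four_conjFree,
      night4Quad_C6xC2_four_injective, night4Quad_C6xC2_four_redDim⟩,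
    ⟨_, night4Quad_D6_four_isCMType, night4Quad_D6_four_sumTwo, night4Quad_D6_four_conjFree,
      night4Quad_D6_four_injective, night4Quad_D6_four_redDim⟩,
    ⟨_, night4Quad_C6xC2_seven_isCMType, night4Quad_C6xC2_seven_sumTwo, night4Quad_C6xC2_seven_conjFree,
      night4Quad_C6xC2_seven_injective, night4Quad_C6xC2_seven_redDim⟩,
    ⟨_, night4Quad_C12_eight_isCMType, night4Quad_C12_eight_sumTwo, night4Quad_C12_eight_conjFree,
      night4Quad_C12_eight_injective, night4Quad_C12_eight_redDim⟩,
    ⟨_, night4Quad_Dic3_eight_isCMType, night4Quad_Dic3_eight_sumTwo, night4Quad_Dic3_eight_conjFree,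
      night4Quad_Dic3_eight_injective, night4Quad_Dic3_eight_redDim⟩⟩

end HodgeRepro
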